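import Summits.HodgeConjecture.HodgeConjecture.Theorems.SignSymmetricPowersGenSameFactor
import Summits.HodgeConjecture.HodgeConjecture.Theorems.SignSymmetricPowersGenPairCentreSign
import Summits.HodgeConjecture.HodgeConjecture.Theorems.SignSymmetricPowersGenFactors
import Summits.HodgeConjecture.HodgeConjecture.Theorems.SignSymmetricPowersGenLoops
import Summits.HodgeConjecture.HodgeConjecture.Theorems.SignSymmetricPowersLinkConjugacy
import Summits.HodgeConjecture.HodgeConjecture.Theorems.SignSymmetricPowersMeridianPencil
import Summits.HodgeConjecture.HodgeConjecture.Theorems.SignSymmetricPowersMeridianMonodromy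
import Literature.AlgebraicGeometry.HodgeTheory.BettiUniverseAxioms
import Literature.AlgebraicGeometry.HodgeTheory.NodalFormPencilNonsingular
import HarnessLib

/-!
# K1-B piece GEN with its co-pencil DIRECTIONS EXPOSED (`g₁ = x₄^d`, `g₂ = x₀^d`, `g₃ = x₂^d`) — PL-free, as in `…MeridianGenerationNoPL`

Prover seat `hodge-nonav-19716-p2` (g10), cell `hodge-nonav`; «v24-prep» (monomial keying of the Picard–Lefschetz binders after prover-Bx g15's
scoping 23:47:30Z).  Landed `--supports stmt-HodgeConjecture-19716` (helper).  VERBATIM `SignSymmetricPowersMeridianGenerationNoPL.signMeridianGeneration`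
with three equations `g₁ = X 4 ^ d ∧ g₂ = X 0 ^ d ∧ g₃ = X 2 ^ d` prepended to its existential conclusion (the proof always used these monomials;
the ∃ merely hid them), so that downstream consumers can feed the MONOMIAL-keyed binders `picardLefschetz_oneNodeMonomial` ∕
`picardLefschetz_exchangedPairMonomial`.

* `signMeridianGeneration_monomial`.

Sorry-free; axioms standard; no definition; named facts only as antecedents (F-ZvK, F-DISC-1; F-DISC-0 inlined and proved).  Nothing here says HC is proved.

## References

* [VoisinHodgeII2003] C. Voisin, Hodge Theory and Complex Algebraic Geometry II (CUP 2003), §2.3, §3.2.2 (Zariski's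
  theorem, Fig. 3.2), §6.2.1.
* [Shimada2010ZvK] I. Shimada, Lectures on Zariski–van Kampen theorem (arXiv:0906.1074), §3 Prop. 3.4.
* [Deligne1974] P. Deligne, La conjecture de Weil I, (5.2).
-/

noncomputable section

set_option linter.dupNamespace false
set_option maxHeartbeats 800000

open MvPolynomial CategoryTheory
open scoped unitInterval
open Literature.AlgebraicTopology.SingularHomology
open Literature.AlgebraicGeometry.Motives Literature.AlgebraicGeometry.Motives.UniversalHypersurface
open Literature.AlgebraicGeometry.HodgeTheory Literature.AlgebraicGeometry.HodgeTheory.UniversalHypersurface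
open Literature.AlgebraicGeometry.HodgeTheory.BettiUniverse
open Literature.AlgebraicGeometry.FundamentalGroup
open Summit.HodgeConjecture.HodgeConjecture.Theorems

namespace Summit.HodgeConjecture.HodgeConjecture.Theorems.SignSymmetricPowersMeridianGenerationMonomial

/-- **GEN without the Picard–Lefschetz antecedent, directions exposed**: `signMeridianGeneration` (PL-free GEN) with the equations
`g₁ = x₄^d`, `g₂ = x₀^d`, `g₃ = x₂^d` recorded in the conclusion.
[cite: VoisinHodgeII2003, §3.2.2 Thm. 3.22 and Fig. 3.2] [cite: Shimada2010ZvK, §3 Prop. 3.4] -/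
theorem signMeridianGeneration_monomial :
    open Literature.AlgebraicGeometry.Motives Literature.AlgebraicGeometry.Motives.UniversalHypersurface Literature.AlgebraicGeometry.HodgeTheory Literature.AlgebraicGeometry.HodgeTheory.UniversalHypersurface Literature.AlgebraicGeometry.HodgeTheory.BettiUniverse CategoryTheory.Limits in Literature.AlgebraicGeometry.FundamentalGroup.affineHypersurfaceComplement_meridians_normalClosure_eq_top → (∀ (n d : ℕ), 2 ≤ d → ∃ Disc : MvPolynomial (Literature.AlgebraicGeometry.Motives.UniversalHypersurface.DegIndex n d) ℂ, Irreducible Disc ∧ Disc.IsHomogeneous Disc.totalDegree ∧ 0 < Disc.totalDegree ∧ ∀ a : Literature.AlgebraicGeometry.Motives.UniversalHypersurface.DegIndex n d → ℂ, a ∈ Literature.AlgebraicGeometry.HodgeTheory.singularCoeffs n d ↔ MvPolynomial.eval a Disc = 0) → discriminant_localBranches_nodal → ∀ ⦃d : ℕ⦄, Even d → ∀ (h4 : 4 ≤ d), (let M : Set (DegIndex 3 d) := {m | Even (m.1 0 + m.1 1)}; let γ : Fin 5 → ℂˣ := fun i => if (i : ℕ) < 2 then -1 else 1; let u := familyM ℂ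 3 d M; let hu : IsSmoothProjectiveFamily u 3 := isSmoothProjectiveFamily_familyM ℂ 3 d M (by decide) (le_trans (by decide) h4); let hU : IsCohomologicallyLocallyTrivialOn u (Set.univ : Set (ComplexPoints (baseM ℂ 3 d M))) := isCohomologicallyLocallyTrivialOn_familyM 3 d M (by decide) (le_trans (by decide) h4); let toU : C(ComplexPoints (baseM ℂ 3 d M), (Set.univ : Set (ComplexPoints (baseM ℂ 3 d M)))) := ⟨fun s => ⟨s, Set.mem_univ s⟩, continuous_id.subtype_mk _⟩; ∀ (hγ : FixesMonomials ℂ 3 d M γ) (t₀ : ComplexPoints (baseM ℂ 3 d M)) (f : MvPolynomial (Fin 5) ℂ) (hf : f.IsHomogeneous d) (hM : IsSupportedOn 3 d M f) (hJ : SmoothHypersurface.IsNonsingularForm ℂ f), let t := classifyingPoint ℂ 3 d M t₀ f; let Y := fiberOver u t; let hY : IsSmoothProjective 3 Y := hu.isSmoothProjective t; let Γ := (haveI := finite hY 3; ratMonodromyGroup u 3 hU ⟨t, Set.mem_univ _⟩); ∀ (f₁ f₂ f₃ : MvPolynomial (Fin 5) ℂ), f₁.IsHomogeneous d → IsSupportedOn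 3 d M f₁ → IsNodalFormWithNodes f₁ ![![0, 0, 0, 0, 1]] → f₂.IsHomogeneous d → IsSupportedOn 3 d M f₂ → IsNodalFormWithNodes f₂ ![![1, 0, 0, 0, 0]] → f₃.IsHomogeneous d → IsSupportedOn 3 d M f₃ → IsNodalFormWithNodes f₃ ![![1, 0, 1, 0, 0], ![-1, 0, 1, 0, 0]] → ∃ (g₁ g₂ g₃ : MvPolynomial (Fin 5) ℂ), g₁ = MvPolynomial.X 4 ^ d ∧ g₂ = MvPolynomial.X 0 ^ d ∧ g₃ = MvPolynomial.X 2 ^ d ∧ g₁.IsHomogeneous d ∧ IsSupportedOn 3 d M g₁ ∧ (∀ i : Fin 1, MvPolynomial.eval (![![0, 0, 0, 0, 1]] i) g₁ ≠ 0) ∧ g₂.IsHomogeneous d ∧ IsSupportedOn 3 d M g₂ ∧ (∀ i : Fin 1, MvPolynomial.eval (![![1, 0, 0, 0, 0]] i) g₂ ≠ 0) ∧ g₃.IsHomogeneous d ∧ IsSupportedOn 3 d M g₃ ∧ (∀ i : Fin 2, MvPolynomial.eval (![![1, 0, 1, 0, 0], ![-1, 0, 1, 0, 0]] i) g₃ ≠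 0) ∧ ∃ ε₁ : ℝ, 0 < ε₁ ∧ ∀ ε : ℝ, 0 < ε → ε < ε₁ → ∃ (s₁ s₂ s₃ : ComplexPoints (baseM ℂ 3 d M)) (β₁ : Path t s₁) (β₂ : Path t s₂) (β₃ : Path t s₃) (ω₁ : Path s₁ s₁) (ω₂ : Path s₂ s₂) (ω₃ : Path s₃ s₃) (T₁ T₂ T₃ : bettiCohomology Y 3 ≃ₗ[ℚ] bettiCohomology Y 3) (E : Set (bettiCohomology Y 3 ≃ₗ[ℚ] bettiCohomology Y 3)), pointFormM ℂ 3 d M s₁ = f₁ + ((ε : ℝ) : ℂ) • g₁ ∧ IsPencilCircle 3 d f₁ g₁ ε (ω₁.map (AlgPoints.mapContinuous (toBase ℂ 3 d M)).continuous) ∧ pointFormM ℂ 3 d M s₂ = f₂ + ((ε : ℝ) : ℂ) • g₂ ∧ IsPencilCircle 3 d f₂ g₂ ε (ω₂.map (AlgPoints.mapContinuous (toBase ℂ 3 d M)).continuous) ∧ pointFormM ℂ 3 d M s₃ = f₃ + ((ε : ℝ) : ℂ) • g₃ ∧ IsPencilCircle 3 d f₃ g₃ ε (ω₃.map (AlgPoints.mapContinuous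 (toBase ℂ 3 d M)).continuous) ∧ IsRatTransport u 3 hU ⟦((β₁.trans ω₁).trans β₁.symm).map toU.continuous⟧ T₁ ∧ IsRatTransport u 3 hU ⟦((β₂.trans ω₂).trans β₂.symm).map toU.continuous⟧ T₂ ∧ IsRatTransport u 3 hU ⟦((β₃.trans ω₃).trans β₃.symm).map toU.continuous⟧ T₃ ∧ Γ = Subgroup.closure E ∧ ∀ e ∈ E, ∃ g ∈ Γ, e = g * T₁ * g⁻¹ ∨ e = g * T₂ * g⁻¹ ∨ e = g * T₃ * g⁻¹) := by
  classical
  intro hZvK hD0 hB d hd h4 M γ u hu hU toU hγ t₀ f hf hM hJ t Y hY Γ f₁ f₂ f₃ hf₁ hM₁ hn₁ hf₂ hM₂ hn₂ hf₃ hM₃ hn₃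
  have hd1 : 1 ≤ d := le_trans (by norm_num) h4
  have hd2 : 2 ≤ d := le_trans (by norm_num) h4
  -- the co-pencil directions
  have hXhom : ∀ i : Fin 5, ((X i : MvPolynomial (Fin 5) ℂ) ^ d).IsHomogeneous d := fun i =>
    by simpa using (isHomogeneous_X ℂ i).pow d
  have hXsupp : ∀ i : Fin 5, Even ((Finsupp.single i d : Fin 5 →₀ ℕ) 0 + (Finsupp.single i d : Fin 5 →₀ ℕ) 1) →
      IsSupportedOn 3 d M ((X i : MvPolynomial (Fin 5) ℂ) ^ d) := by
    intro i hi m hm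
    rw [X_pow_eq_monomial, coeff_monomial, if_neg]
    intro hmi
    apply hm
    show Even (m.1 0 + m.1 1)
    rw [← hmi]; exact hi
  have hg₁ := hXhom 4
  have hg₂ := hXhom 0
  have hg₃ := hXhom 2
  have hMg₁ : IsSupportedOn 3 d M ((X 4 : MvPolynomial (Fin 5) ℂ) ^ d) := hXsupp 4 (by simp)
  have hMg₂ : IsSupportedOn 3 d M ((X 0 : MvPolynomial (Fin 5) ℂ) ^ d) :=
    hXsupp 0 (by simpa [Finsupp.single_apply] using hd)
  have hMg₃ : IsSupportedOn 3 d M ((X 2 : MvPolynomial (Fin 5) ℂ) ^ d) := hXsupp 2 (by simp)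
  have hev : ∀ (i : Fin 5) (z : Fin 5 → ℂ), MvPolynomial.eval z ((X i : MvPolynomial (Fin 5) ℂ) ^ d) = z i ^ d :=
    fun i z => by rw [map_pow, eval_X]
  have hg₁e : ∀ i : Fin 1, MvPolynomial.eval (![![0, 0, 0, 0, 1]] i) ((X 4 : MvPolynomial (Fin 5) ℂ) ^ d) ≠ 0 := by
    intro i; fin_cases i; rw [hev]; simp
  have hg₂e : ∀ i : Fin 1, MvPolynomial.eval (![![1, 0, 0, 0, 0]] i) ((X 0 : MvPolynomial (Fin 5) ℂ) ^ d) ≠ 0 := by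
    intro i; fin_cases i; rw [hev]; simp
  have hg₃e : ∀ i : Fin 2, MvPolynomial.eval (![![1, 0, 1, 0, 0], ![-1, 0, 1, 0, 0]] i)
      ((X 2 : MvPolynomial (Fin 5) ℂ) ^ d) ≠ 0 := by
    intro i; fin_cases i <;> rw [hev] <;> simp
  refine ⟨X 4 ^ d, X 0 ^ d, X 2 ^ d, rfl, rfl, rfl, hg₁, hMg₁, hg₁e, hg₂, hMg₂, hg₂e, hg₃, hMg₃, hg₃e, ?_⟩
  -- the discriminant and its restriction to `A_M`
  obtain ⟨Disc, hirrD, -, -, hV⟩ := hD0 3 d hd2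
  have hD0' : killHom ℂ 3 d M Disc ≠ 0 := by
    intro h0
    have hmem : ((coeffVector ℂ 3 d (AlgPoints.map (toBase ℂ 3 d M) t)) ∘ (Subtype.val : M → DegIndex 3 d)) ∈
        Set.range (fun t : ComplexPoints (baseM ℂ 3 d M) =>
          (coeffVector ℂ 3 d (AlgPoints.map (toBase ℂ 3 d M) t)) ∘ (Subtype.val : M → DegIndex 3 d)) := ⟨t, rfl⟩
    rw [SignSymmetricPowersMeridianChart.range_coeffChart_eq 3 d M hV] at hmem
    exact hmem (by rw [h0, map_zero])
  obtain ⟨m, h, e, w, hw, hirr, hna, he, hfac, hcompl⟩ :=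
    SignSymmetricPowersGenFactors.exists_distinct_irreducible_factors _ hD0'
  -- the chart onto the complement of the listed factors
  obtain ⟨eH, heH⟩ := SignSymmetricPowersLinkConjugacy.exists_homeomorph_of_complement_eq 3 d M hV h hcompl
  -- the unique factor through each witness, with the `Meridian` fields
  obtain ⟨j₁, -, ⟨hj₁0, hj₁ne, htr₁⟩, -⟩ :=
    SignSymmetricPowersLinkConjugacy.exists_common_factor_of_node_at_pow 3 d M hB hirrD hV hd1 hw h he hfac
      hf₁ hg₁ hf₁ hg₁ hM₁ hMg₁ hM₁ hMg₁ hn₁ hn₁ (hg₁e 0) (hg₁e 0)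
  obtain ⟨j₂, -, ⟨hj₂0, hj₂ne, htr₂⟩, -⟩ :=
    SignSymmetricPowersLinkConjugacy.exists_common_factor_of_node_at_pow 3 d M hB hirrD hV hd1 hw h he hfac
      hf₂ hg₂ hf₂ hg₂ hM₂ hMg₂ hM₂ hMg₂ hn₂ hn₂ (hg₂e 0) (hg₂e 0)
  obtain ⟨j₃, hj₃0, -, hj₃ne, htr₃⟩ :=
    SignSymmetricPowersGenPairCentreSign.exists_unique_factor_signPair hB hd1 hirrD hV hγ w hw h e hirr hna he hfac
      hf₃ hM₃ hn₃ hg₃ hMg₃ (hg₃e 0)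
  -- every listed factor is the factor of one of the three witnesses (COVERAGE + uniqueness)
  have hwhich : ∀ j, j = j₁ ∨ j = j₂ ∨ j = j₃ := by
    intro j
    have hdvd : h j ∣ killHom ℂ 3 d M Disc := by
      rw [hfac]
      exact Dvd.dvd.mul_left ((dvd_pow_self (h j) (by have := he j; omega)).trans
        (Finset.dvd_prod_of_mem (fun j => h j ^ e j) (Finset.mem_univ j))) w
    have hcov := SignSymmetricPowersGenCoverage.prime_factor_eval_witness_eq_zero hd2 M
      SignSymmetricPowersGenCoverage.mem_signMonomials_iff_unitWeight hV hD0' (hirr j) hdvd hf₁ hf₂ hf₃ hM₁ hM₂ hM₃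
      (fun jj => (hn₁.1 0).eval_pderiv jj) (fun jj => (hn₂.1 0).eval_pderiv jj) (fun jj => (hn₃.1 0).eval_pderiv jj)
    rcases hcov with h1 | h2 | h3
    · left; by_contra hne; exact hj₁ne j hne h1
    · right; left; by_contra hne; exact hj₂ne j hne h2
    · right; right; by_contra hne; exact hj₃ne j hne h3
  -- the nonsingularity radii of the three pencils (clause (i) of F-PL, now the theorem of `NodalFormPencilNonsingular`)
  obtain ⟨ε₁', hε₁', hns₁⟩ := hn₁.exists_isNonsingularForm_add_smul hd1 hf₁ hg₁ hg₁e
  obtain ⟨ε₂', hε₂', hns₂⟩ := hn₂.exists_isNonsingularForm_add_smul hd1 hf₂ hg₂ hg₂e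
  obtain ⟨ε₃', hε₃', hns₃⟩ := hn₃.exists_isNonsingularForm_add_smul hd1 hf₃ hg₃ hg₃e
  refine ⟨min ε₁' (min ε₂' ε₃'), lt_min hε₁' (lt_min hε₂' hε₃'), fun ε hε hεlt => ?_⟩
  have hε1 : ε < ε₁' := lt_of_lt_of_le hεlt (min_le_left _ _)
  have hε2 : ε < ε₂' := lt_of_lt_of_le hεlt ((min_le_right _ _).trans (min_le_left _ _))
  have hε3 : ε < ε₃' := lt_of_lt_of_le hεlt ((min_le_right _ _).trans (min_le_right _ _))
  have hns₁' : ∀ c : ℂ, c ≠ 0 → ‖c‖ ≤ ε → SmoothHypersurface.IsNonsingularForm ℂ (f₁ + c • X 4 ^ d) :=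
    fun c hc hcε => hns₁ c hc (lt_of_le_of_lt hcε hε1)
  have hns₂' : ∀ c : ℂ, c ≠ 0 → ‖c‖ ≤ ε → SmoothHypersurface.IsNonsingularForm ℂ (f₂ + c • X 0 ^ d) :=
    fun c hc hcε => hns₂ c hc (lt_of_le_of_lt hcε hε2)
  have hns₃' : ∀ c : ℂ, c ≠ 0 → ‖c‖ ≤ ε → SmoothHypersurface.IsNonsingularForm ℂ (f₃ + c • X 2 ^ d) :=
    fun c hc hcε => hns₃ c hc (lt_of_le_of_lt hcε hε3)
  -- the three pencil loops, moved to `t`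
  obtain ⟨s₁, β₁, ω₁, hs₁, hω₁⟩ := SignSymmetricPowersGenLoops.exists_pencilLoop 3 d M hf₁ hg₁ hM₁ hMg₁ hε hns₁' t
  obtain ⟨s₂, β₂, ω₂, hs₂, hω₂⟩ := SignSymmetricPowersGenLoops.exists_pencilLoop 3 d M hf₂ hg₂ hM₂ hMg₂ hε hns₂' t
  obtain ⟨s₃, β₃, ω₃, hs₃, hω₃⟩ := SignSymmetricPowersGenLoops.exists_pencilLoop 3 d M hf₃ hg₃ hM₃ hMg₃ hε hns₃' t
  -- they are loops of meridians of the corresponding components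
  obtain ⟨μ₁, -, -, -, hμ₁⟩ := SignSymmetricPowersMeridianPencil.exists_meridian_of_pencilCircle 3 d M eH heH hf₁ hg₁
    hM₁ hMg₁ hj₁0 hj₁ne htr₁ hε hns₁' β₁ hs₁ ω₁ hω₁
  obtain ⟨μ₂, -, -, -, hμ₂⟩ := SignSymmetricPowersMeridianPencil.exists_meridian_of_pencilCircle 3 d M eH heH hf₂ hg₂
    hM₂ hMg₂ hj₂0 hj₂ne htr₂ hε hns₂' β₂ hs₂ ω₂ hω₂
  obtain ⟨μ₃, -, -, -, hμ₃⟩ := SignSymmetricPowersMeridianPencil.exists_meridian_of_pencilCircle 3 d M eH heH hf₃ hg₃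
    hM₃ hMg₃ hj₃0 hj₃ne htr₃ hε hns₃' β₃ hs₃ ω₃ hω₃
  -- notation for the transfer map and the three loop classes on the subtype `Set.univ`
  set φ : C(affineHypersurfaceComplement h, (Set.univ : Set (ComplexPoints (baseM ℂ 3 d M)))) :=
    ⟨fun z => ⟨eH.symm z, Set.mem_univ _⟩, (continuous_id.subtype_mk _).comp eH.symm.continuous⟩ with hφ
  have hφt : φ (eH t) = ⟨t, Set.mem_univ t⟩ := Subtype.ext (eH.symm_apply_apply t)
  set q₁ : Path.Homotopic.Quotient (⟨t, Set.mem_univ t⟩ : (Set.univ : Set (ComplexPoints (baseM ℂ 3 d M))))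
      ⟨t, Set.mem_univ t⟩ := Path.Homotopic.Quotient.mk (((β₁.trans ω₁).trans β₁.symm).map toU.continuous) with hq₁
  set q₂ : Path.Homotopic.Quotient (⟨t, Set.mem_univ t⟩ : (Set.univ : Set (ComplexPoints (baseM ℂ 3 d M))))
      ⟨t, Set.mem_univ t⟩ := Path.Homotopic.Quotient.mk (((β₂.trans ω₂).trans β₂.symm).map toU.continuous) with hq₂
  set q₃ : Path.Homotopic.Quotient (⟨t, Set.mem_univ t⟩ : (Set.univ : Set (ComplexPoints (baseM ℂ 3 d M))))
      ⟨t, Set.mem_univ t⟩ := Path.Homotopic.Quotient.mk (((β₃.trans ω₃).trans β₃.symm).map toU.continuous) with hq₃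
  -- one meridian per listed factor, each a copy of one of the three
  have hall : ∀ j, ∃ μ : Meridian h (eH t) j,
      FundamentalGroup.toPath (FundamentalGroup.mapOfEq φ hφt μ.loopClass) = q₁ ∨
      FundamentalGroup.toPath (FundamentalGroup.mapOfEq φ hφt μ.loopClass) = q₂ ∨
      FundamentalGroup.toPath (FundamentalGroup.mapOfEq φ hφt μ.loopClass) = q₃ := by
    intro j
    rcases hwhich j with rfl | rfl | rfl
    · exact ⟨μ₁, Or.inl hμ₁⟩
    · exact ⟨μ₂, Or.inr (Or.inl hμ₂)⟩
    · exact ⟨μ₃, Or.inr (Or.inr hμ₃)⟩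
  choose μ hμ using hall
  -- F-ZvK in the complement, transferred to `S_M(ℂ)`
  have hN : Subgroup.normalClosure (Set.range fun j => (μ j).loopClass) = ⊤ := hZvK M m h hirr (eH t) μ
  let EH : affineHypersurfaceComplement h ≃ₜ (Set.univ : Set (ComplexPoints (baseM ℂ 3 d M))) :=
    eH.symm.trans (Homeomorph.Set.univ _).symm
  have hEH : (EH : C(affineHypersurfaceComplement h, (Set.univ : Set (ComplexPoints (baseM ℂ 3 d M))))) = φ :=
    ContinuousMap.ext fun z => rfl
  have hEHt : EH (eH t) = ⟨t, Set.mem_univ t⟩ := Subtype.ext (eH.symm_apply_apply t)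
  have hN' : Subgroup.normalClosure (FundamentalGroup.mapOfEq φ hφt '' Set.range (fun j => (μ j).loopClass)) = ⊤ :=
    SignSymmetricPowersMeridianMonodromy.normalClosure_image_mapOfEq_eq_top EH hEHt hN
  -- the monodromy representation and the transports along the three loops
  have hrat : ∀ (s s' : (Set.univ : Set (ComplexPoints (baseM ℂ 3 d M)))) (δ : Path.Homotopic.Quotient s s')
      (α : complexBetti (fiberOver u s.1) 3), IsRationalClass α → IsRationalClass (transportFun u 3 hU δ α) :=
    fun _ _ δ _ hα => isRationalClass_transportFun_familyM 3 d M (by norm_num) hd1 3 hU δ hα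
  obtain ⟨ρ, hρ, hρrange⟩ := SignSymmetricPowersMeridianMonodromy.exists_monodromyHom u 3 hU hrat ⟨t, Set.mem_univ t⟩
  refine ⟨s₁, s₂, s₃, β₁, β₂, β₃, ω₁, ω₂, ω₃, ρ (FundamentalGroup.fromPath q₁), ρ (FundamentalGroup.fromPath q₂),
    ρ (FundamentalGroup.fromPath q₃),
    {x | ∃ g ∈ ratMonodromyGroup u 3 hU ⟨t, Set.mem_univ t⟩,
      ∃ c ∈ FundamentalGroup.mapOfEq φ hφt '' Set.range (fun j => (μ j).loopClass), x = g * ρ c * g⁻¹},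
    hs₁, hω₁, hs₂, hω₂, hs₃, hω₃, hρ _, hρ _, hρ _, ?_, ?_⟩
  · -- `Γ = closure E` (F-ZvK consumer)
    exact SignSymmetricPowersMeridianMonodromy.ratMonodromyGroup_eq_closure_conj u 3 hU hrat ⟨t, Set.mem_univ t⟩ hN'
      ρ (fun c _ => hρ c)
  · -- every generator is a conjugate of one of the three transports
    rintro x ⟨g, hg, c, ⟨_, ⟨j, rfl⟩, rfl⟩, rfl⟩
    refine ⟨g, hg, ?_⟩
    rcases hμ j with hj | hj | hj
    · left
      have : FundamentalGroup.mapOfEq φ hφt (μ j).loopClass = FundamentalGroup.fromPath q₁ := by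
        rw [← hj]
      rw [this]
    · right; left
      have : FundamentalGroup.mapOfEq φ hφt (μ j).loopClass = FundamentalGroup.fromPath q₂ := by
        rw [← hj]
      rw [this]
    · right; right
      have : FundamentalGroup.mapOfEq φ hφt (μ j).loopClass = FundamentalGroup.fromPath q₃ := by
        rw [← hj]
      rw [this]

end Summit.HodgeConjecture.HodgeConjecture.Theorems.SignSymmetricPowersMeridianGenerationMonomial

end
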